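import Summits.AtomisticToContinuum.HydrodynamicLimit.Theorems.JParityClosureKineticEnergyTailsApriori
import HarnessLib

/-!
# Assembly of route `OneSphereInfluence` (stmt-AtomisticToContinuum-14700): moment bounds

Helper file for the proof of the assembly item
`Summit.AtomisticToContinuum.HydrodynamicLimit.Theses.OneSphereInfluence.Assembly`
(sub-problem `HydrodynamicLimit`). Pure measure theory on the local Gibbs measure
`localGibbsMeasure σ a₀ u₀ θ₀ N` of `N + 1` hard spheres (`HardSphereEulerProofs.lean`):

* fourth velocity moments are bounded uniformly in `N` (conditionally on the positions the
  velocities are independent Gaussians `N(u₀(xᵢ), θ₀(xᵢ) id)`; disintegration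
  `lintegral_localGibbsMeasure`);
* consequently every observable dominated by `C (1 + (N+1)⁻¹ ∑ᵢ |vᵢ|²)` — such as the empirical
  density / momentum / energy fields tested against a bounded `χ`, at any time, by conservation of
  the kinetic energy along the hard-sphere flow — is in `L²` with a second moment bounded
  uniformly in `N`;
* the kinetic energy is conserved along the flow on the good set, which is conull for the local
  Gibbs measure.

No definitions, no named facts; everything is folklore probability. Declarations live in the
sub-namespace `…Theorems.OneSphereInfluenceAssembly` to keep the flat `Theorems` namespace clean.
-/

noncomputable section

open MeasureTheory ProbabilityTheory Filter Set Topology Real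
open scoped ENNReal NNReal InnerProductSpace

namespace Summit.AtomisticToContinuum.HydrodynamicLimit.Theorems.OneSphereInfluenceAssembly

open Literature.Analysis.FluidPDE Literature.MathematicalPhysics.KineticTheory

/-! ## Fourth moments of Gaussian velocities (`integral_norm_pow_four_gaussMeasure_le` is in
`JParityClosureKineticEnergyTailsApriori.lean`) -/

/-- The uniform fourth-moment constant `8 (U⁴ + Θ² E|w|⁴)` is nonnegative. [folklore] -/
theorem fourthMomentBound_nonneg (U Θ : ℝ) :
    0 ≤ 8 * (U ^ 4 + Θ ^ 2 * ∫ w, ‖w‖ ^ 4 ∂stdGaussian V3) := by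
  have h4 : 0 ≤ ∫ w, ‖w‖ ^ 4 ∂stdGaussian V3 := integral_nonneg fun w => by positivity
  positivity

variable {a₀ θ₀ : T3 → ℝ} {u₀ : T3 → V3}

/-- **Fourth velocity moments under the local Gibbs measure**, uniformly in `N`: if `|u₀| ≤ U` and
`θ₀ ≤ Θ` then `E_{P_N} |vᵢ|⁴ ≤ 8 (U⁴ + Θ² E|w|⁴)` for every particle `i` (disintegration into
positions and independent Gaussian velocities). [folklore] -/
theorem lintegral_norm_vel_pow_four_le (ha : Continuous a₀) (hθ : Continuous θ₀)
    (hu : Continuous u₀) (ha0 : ∀ x, 0 ≤ a₀ x) (hθ0 : ∀ x, 0 < θ₀ x) {U Θ : ℝ}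
    (hU : ∀ x, ‖u₀ x‖ ≤ U) (hΘ : ∀ x, θ₀ x ≤ Θ) (σ : ℝ) (N : ℕ)
    [IsProbabilityMeasure (localGibbsMeasure σ a₀ u₀ θ₀ N)] (i : Fin (N + 1)) :
    ∫⁻ z, ENNReal.ofReal (‖(z i).2‖ ^ 4) ∂localGibbsMeasure σ a₀ u₀ θ₀ N ≤
      ENNReal.ofReal (8 * (U ^ 4 + Θ ^ 2 * ∫ w, ‖w‖ ^ 4 ∂stdGaussian V3)) := by
  set M : ℝ := 8 * (U ^ 4 + Θ ^ 2 * ∫ w, ‖w‖ ^ 4 ∂stdGaussian V3) with hM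
  have hGm : Measurable fun z : Config (N + 1) (Fin 3) T3 => ENNReal.ofReal (‖(z i).2‖ ^ 4) :=
    ((measurable_pi_apply i).snd.norm.pow_const 4).ennreal_ofReal
  have hU0 : 0 ≤ U := (norm_nonneg _).trans (hU 0)
  -- velocity integral, uniformly in the positions
  have hvel : ∀ x : Fin (N + 1) → T3,
      ∫⁻ v, ENNReal.ofReal (‖(zipConfig (x, v) i).2‖ ^ 4) ∂velMeasure u₀ θ₀ x ≤ ENNReal.ofReal M := by
    intro x
    have hmp := measurePreserving_eval (fun j : Fin (N + 1) => gaussMeasure (u₀ (x j)) (θ₀ (x j))) i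
    have hf : Measurable fun w : V3 => ENNReal.ofReal (‖w‖ ^ 4) :=
      (measurable_norm.pow_const 4).ennreal_ofReal
    have h1 : ∫⁻ v, ENNReal.ofReal (‖(zipConfig (x, v) i).2‖ ^ 4) ∂velMeasure u₀ θ₀ x =
        ∫⁻ w, ENNReal.ofReal (‖w‖ ^ 4) ∂gaussMeasure (u₀ (x i)) (θ₀ (x i)) := by
      simp only [zipConfig_apply]
      exact hmp.lintegral_comp hf
    have hint : Integrable (fun w : V3 => ‖w‖ ^ 4) (gaussMeasure (u₀ (x i)) (θ₀ (x i))) :=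
      integrable_norm_pow_four_gaussMeasure _ _
    rw [h1, ← ofReal_integral_eq_lintegral_ofReal hint (Eventually.of_forall fun w => by positivity)]
    refine ENNReal.ofReal_le_ofReal ?_
    refine (integral_norm_pow_four_gaussMeasure_le (u₀ (x i)) (hθ0 (x i))).trans ?_
    have h4 : 0 ≤ ∫ w, ‖w‖ ^ 4 ∂stdGaussian V3 := integral_nonneg fun w => by positivity
    have hu4 : ‖u₀ (x i)‖ ^ 4 ≤ U ^ 4 := pow_le_pow_left₀ (norm_nonneg _) (hU (x i)) 4
    have hθ2 : θ₀ (x i) ^ 2 ≤ Θ ^ 2 := pow_le_pow_left₀ (hθ0 (x i)).le (hΘ (x i)) 2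
    rw [hM]
    nlinarith [mul_le_mul_of_nonneg_right hθ2 h4]
  calc ∫⁻ z, ENNReal.ofReal (‖(z i).2‖ ^ 4) ∂localGibbsMeasure σ a₀ u₀ θ₀ N
      = ∫⁻ x, ENNReal.ofReal ((canonicalPartition (Torus.geometry (Fin 3)) (hsDiameter σ N)
          (N + 1) (localGibbsProfile a₀ u₀ θ₀))⁻¹ * posWeight a₀ (hsDiameter σ N) (N + 1) x) *
          ∫⁻ v, ENNReal.ofReal (‖(zipConfig (x, v) i).2‖ ^ 4) ∂velMeasure u₀ θ₀ x :=
        lintegral_localGibbsMeasure ha hθ hu ha0 hθ0 σ N hGm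
    _ ≤ ∫⁻ x, ENNReal.ofReal ((canonicalPartition (Torus.geometry (Fin 3)) (hsDiameter σ N)
          (N + 1) (localGibbsProfile a₀ u₀ θ₀))⁻¹ * posWeight a₀ (hsDiameter σ N) (N + 1) x) *
          ENNReal.ofReal M :=
        lintegral_mono fun x => mul_le_mul_right (hvel x) _
    _ = ENNReal.ofReal M := by
        have hρm : Measurable fun x : Fin (N + 1) → T3 => ENNReal.ofReal
            ((canonicalPartition (Torus.geometry (Fin 3)) (hsDiameter σ N) (N + 1)
              (localGibbsProfile a₀ u₀ θ₀))⁻¹ * posWeight a₀ (hsDiameter σ N) (N + 1) x) :=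
          (measurable_const.mul (measurable_posWeight ha _ _)).ennreal_ofReal
        rw [lintegral_mul_const _ hρm, lintegral_posWeight_eq_one ha hθ hu ha0 hθ0 σ N, one_mul]

/-- `|vᵢ|⁴` is integrable under the local Gibbs measure (bounded profiles). [folklore] -/
theorem integrable_norm_vel_pow_four (ha : Continuous a₀) (hθ : Continuous θ₀)
    (hu : Continuous u₀) (ha0 : ∀ x, 0 ≤ a₀ x) (hθ0 : ∀ x, 0 < θ₀ x) {U Θ : ℝ}
    (hU : ∀ x, ‖u₀ x‖ ≤ U) (hΘ : ∀ x, θ₀ x ≤ Θ) (σ : ℝ) (N : ℕ)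
    [IsProbabilityMeasure (localGibbsMeasure σ a₀ u₀ θ₀ N)] (i : Fin (N + 1)) :
    Integrable (fun z : Config (N + 1) (Fin 3) T3 => ‖(z i).2‖ ^ 4) (localGibbsMeasure σ a₀ u₀ θ₀ N) := by
  have hm : AEStronglyMeasurable (fun z : Config (N + 1) (Fin 3) T3 => ‖(z i).2‖ ^ 4)
      (localGibbsMeasure σ a₀ u₀ θ₀ N) :=
    ((measurable_pi_apply i).snd.norm.pow_const 4).aestronglyMeasurable
  refine ⟨hm, ?_⟩
  rw [hasFiniteIntegral_iff_ofReal (Eventually.of_forall fun z => by positivity)]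
  exact (lintegral_norm_vel_pow_four_le ha hθ hu ha0 hθ0 hU hΘ σ N i).trans_lt ENNReal.ofReal_lt_top

/-- The second velocity moment of particle `i` is square integrable under the local Gibbs
measure, with `E (|vᵢ|²)² ≤ 8 (U⁴ + Θ² E|w|⁴)`. [folklore] -/
theorem integral_norm_vel_pow_four_le (ha : Continuous a₀) (hθ : Continuous θ₀)
    (hu : Continuous u₀) (ha0 : ∀ x, 0 ≤ a₀ x) (hθ0 : ∀ x, 0 < θ₀ x) {U Θ : ℝ}
    (hU : ∀ x, ‖u₀ x‖ ≤ U) (hΘ : ∀ x, θ₀ x ≤ Θ) (σ : ℝ) (N : ℕ)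
    [IsProbabilityMeasure (localGibbsMeasure σ a₀ u₀ θ₀ N)] (i : Fin (N + 1)) :
    ∫ z, ‖(z i).2‖ ^ 4 ∂localGibbsMeasure σ a₀ u₀ θ₀ N ≤
      8 * (U ^ 4 + Θ ^ 2 * ∫ w, ‖w‖ ^ 4 ∂stdGaussian V3) := by
  have h := lintegral_norm_vel_pow_four_le ha hθ hu ha0 hθ0 hU hΘ σ N i
  rw [← ofReal_integral_eq_lintegral_ofReal (integrable_norm_vel_pow_four ha hθ hu ha0 hθ0 hU hΘ σ N i)
    (Eventually.of_forall fun z => by positivity)] at h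
  exact (ENNReal.ofReal_le_ofReal_iff (fourthMomentBound_nonneg U Θ)).1 h

/-! ## Observables dominated by the kinetic energy are in `L²`, uniformly in `N` -/

/-- Jensen for the empirical mean of the kinetic energies:
`((N+1)⁻¹ ∑ᵢ |vᵢ|²)² ≤ (N+1)⁻¹ ∑ᵢ |vᵢ|⁴`. [folklore] -/
theorem sq_avg_norm_sq_le {N : ℕ} (z : Config (N + 1) (Fin 3) T3) :
    (((N + 1 : ℕ) : ℝ)⁻¹ * ∑ i, ‖(z i).2‖ ^ 2) ^ 2 ≤ ((N + 1 : ℕ) : ℝ)⁻¹ * ∑ i, ‖(z i).2‖ ^ 4 := by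
  have hn : (0 : ℝ) < ((N + 1 : ℕ) : ℝ) := by positivity
  have hcs := sq_sum_le_card_mul_sum_sq (s := (Finset.univ : Finset (Fin (N + 1))))
    (f := fun i => ‖(z i).2‖ ^ 2)
  simp only [Finset.card_univ, Fintype.card_fin] at hcs
  have h4 : ∀ i : Fin (N + 1), (‖(z i).2‖ ^ 2) ^ 2 = ‖(z i).2‖ ^ 4 := fun i => by ring
  simp only [h4] at hcs
  rw [mul_pow, sq, mul_assoc]
  refine mul_le_mul_of_nonneg_left ?_ (inv_nonneg.2 hn.le)
  rw [inv_mul_le_iff₀ hn]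
  exact hcs

/-- **Energy-dominated observables are square integrable, uniformly in `N`.** Under the local
Gibbs measure with bounded profiles (`|u₀| ≤ U`, `θ₀ ≤ Θ`), a measurable `G` with
`|G| ≤ C (1 + (N+1)⁻¹ ∑ᵢ |vᵢ|²)` a.e. is in `L²` and
`E G² ≤ 2 C² (1 + 8 (U⁴ + Θ² E|w|⁴))`. [folklore] -/
theorem memLp_two_of_abs_le_energy (ha : Continuous a₀) (hθ : Continuous θ₀)
    (hu : Continuous u₀) (ha0 : ∀ x, 0 ≤ a₀ x) (hθ0 : ∀ x, 0 < θ₀ x) {U Θ : ℝ}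
    (hU : ∀ x, ‖u₀ x‖ ≤ U) (hΘ : ∀ x, θ₀ x ≤ Θ) (σ : ℝ) (N : ℕ)
    [IsProbabilityMeasure (localGibbsMeasure σ a₀ u₀ θ₀ N)]
    {G : Config (N + 1) (Fin 3) T3 → ℝ} (hGm : AEStronglyMeasurable G (localGibbsMeasure σ a₀ u₀ θ₀ N))
    {C : ℝ} (hC : 0 ≤ C)
    (hGb : ∀ᵐ z ∂localGibbsMeasure σ a₀ u₀ θ₀ N,
      |G z| ≤ C * (1 + ((N + 1 : ℕ) : ℝ)⁻¹ * ∑ i, ‖(z i).2‖ ^ 2)) :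
    MemLp G 2 (localGibbsMeasure σ a₀ u₀ θ₀ N) ∧
      ∫ z, G z ^ 2 ∂localGibbsMeasure σ a₀ u₀ θ₀ N ≤
        2 * C ^ 2 * (1 + 8 * (U ^ 4 + Θ ^ 2 * ∫ w, ‖w‖ ^ 4 ∂stdGaussian V3)) := by
  set P := localGibbsMeasure σ a₀ u₀ θ₀ N with hP
  set M : ℝ := 8 * (U ^ 4 + Θ ^ 2 * ∫ w, ‖w‖ ^ 4 ∂stdGaussian V3) with hM
  set H : Config (N + 1) (Fin 3) T3 → ℝ :=
    fun z => C * (1 + ((N + 1 : ℕ) : ℝ)⁻¹ * ∑ i, ‖(z i).2‖ ^ 2) with hH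
  have hn : (0 : ℝ) < ((N + 1 : ℕ) : ℝ) := by positivity
  have hHnn : ∀ z, 0 ≤ H z := fun z => mul_nonneg hC (by positivity)
  have hHm : AEStronglyMeasurable H P := by
    refine (Measurable.aestronglyMeasurable ?_)
    refine measurable_const.mul (measurable_const.add (measurable_const.mul ?_))
    exact Finset.measurable_sum _ fun i _ => (measurable_pi_apply i).snd.norm.pow_const 2
  -- `H²` is integrable with the stated bound
  have h4 : ∀ i : Fin (N + 1), Integrable (fun z : Config (N + 1) (Fin 3) T3 => ‖(z i).2‖ ^ 4) P :=
    fun i => integrable_norm_vel_pow_four ha hθ hu ha0 hθ0 hU hΘ σ N i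
  have hB : Integrable (fun z : Config (N + 1) (Fin 3) T3 =>
      2 * C ^ 2 * (1 + ((N + 1 : ℕ) : ℝ)⁻¹ * ∑ i, ‖(z i).2‖ ^ 4)) P :=
    ((integrable_const _).add ((integrable_finsetSum _ fun i _ => h4 i).const_mul _)).const_mul _
  have hH2le : ∀ z, H z ^ 2 ≤ 2 * C ^ 2 * (1 + ((N + 1 : ℕ) : ℝ)⁻¹ * ∑ i, ‖(z i).2‖ ^ 4) := by
    intro z
    have hj := sq_avg_norm_sq_le z
    have hs0 : 0 ≤ ((N + 1 : ℕ) : ℝ)⁻¹ * ∑ i, ‖(z i).2‖ ^ 2 := by positivity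
    rw [hH]
    nlinarith [sq_nonneg C, sq_nonneg (((N + 1 : ℕ) : ℝ)⁻¹ * ∑ i, ‖(z i).2‖ ^ 2 - 1)]
  have hH2 : Integrable (fun z => H z ^ 2) P :=
    hB.mono' (hHm.pow 2) (Eventually.of_forall fun z => by
      rw [Real.norm_eq_abs, abs_of_nonneg (sq_nonneg _)]
      exact hH2le z)
  have hHmem : MemLp H 2 P := (memLp_two_iff_integrable_sq hHm).2 hH2
  have hGH : ∀ᵐ z ∂P, ‖G z‖ ≤ ‖H z‖ := by
    filter_upwards [hGb] with z hz
    rw [Real.norm_eq_abs, Real.norm_eq_abs, abs_of_nonneg (hHnn z)]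
    exact hz
  have hGmem : MemLp G 2 P := hHmem.of_le hGm hGH
  refine ⟨hGmem, ?_⟩
  have hG2 : Integrable (fun z => G z ^ 2) P := (memLp_two_iff_integrable_sq hGm).1 hGmem
  calc ∫ z, G z ^ 2 ∂P ≤ ∫ z, H z ^ 2 ∂P := by
        refine integral_mono_ae hG2 hH2 ?_
        filter_upwards [hGH] with z hz
        rw [Real.norm_eq_abs, Real.norm_eq_abs] at hz
        exact sq_le_sq.2 hz
    _ ≤ ∫ z, 2 * C ^ 2 * (1 + ((N + 1 : ℕ) : ℝ)⁻¹ * ∑ i, ‖(z i).2‖ ^ 4) ∂P :=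
        integral_mono hH2 hB hH2le
    _ = 2 * C ^ 2 * (1 + ((N + 1 : ℕ) : ℝ)⁻¹ * ∑ i, ∫ z, ‖(z i).2‖ ^ 4 ∂P) := by
        rw [integral_const_mul, integral_add (integrable_const _)
          ((integrable_finsetSum _ fun i _ => h4 i).const_mul _), integral_const_mul,
          integral_finsetSum _ fun i _ => h4 i]
        simp
    _ ≤ 2 * C ^ 2 * (1 + M) := by
        have hsum : ∑ i, ∫ z, ‖(z i).2‖ ^ 4 ∂P ≤ ∑ _i : Fin (N + 1), M :=
          Finset.sum_le_sum fun i _ => integral_norm_vel_pow_four_le ha hθ hu ha0 hθ0 hU hΘ σ N i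
        have havg : ((N + 1 : ℕ) : ℝ)⁻¹ * ∑ i, ∫ z, ‖(z i).2‖ ^ 4 ∂P ≤ M := by
          calc ((N + 1 : ℕ) : ℝ)⁻¹ * ∑ i, ∫ z, ‖(z i).2‖ ^ 4 ∂P
              ≤ ((N + 1 : ℕ) : ℝ)⁻¹ * ∑ _i : Fin (N + 1), M :=
                mul_le_mul_of_nonneg_left hsum (inv_nonneg.2 hn.le)
            _ = M := by
                simp only [Finset.sum_const, Finset.card_univ, Fintype.card_fin, nsmul_eq_mul]
                field_simp
        have hC2 : 0 ≤ 2 * C ^ 2 := by positivity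
        nlinarith

/-! ## The hard-sphere flow: good set and energy conservation -/

variable {ε : ℝ} {n : ℕ}

/-- Local-Gibbs-almost every configuration is good for the flow (the law is absolutely continuous
with respect to the Liouville measure). [folklore] -/
theorem ae_mem_good_localGibbsMeasure (σ : ℝ) (a₀ : T3 → ℝ) (u₀ : T3 → V3) (θ₀ : T3 → ℝ) (N : ℕ)
    (Φ : HardSphereFlow (Torus.geometry (Fin 3)) (hsDiameter σ N) (N + 1)) :
    ∀ᵐ z ∂localGibbsMeasure σ a₀ u₀ θ₀ N, z ∈ Φ.good :=
  (localGibbsMeasure_absolutelyContinuous σ a₀ u₀ θ₀ N Φ).ae_le Φ.ae_mem_good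

/-- Lebesgue-almost every configuration of the hard-sphere domain is good for the flow. [folklore] -/
theorem ae_mem_good_of_mem_hardSphereDomain
    (Φ : HardSphereFlow (Torus.geometry (Fin 3)) ε n) :
    ∀ᵐ z ∂(volume : Measure (Config n (Fin 3) T3)),
      z ∈ hardSphereDomain (Torus.geometry (Fin 3)) n ε → z ∈ Φ.good := by
  rw [← ae_restrict_iff' (measurableSet_hardSphereDomain _ Torus.measurable_geometry_sepVec n ε)]
  have h : (volume.restrict (hardSphereDomain (Torus.geometry (Fin 3)) n ε)) Φ.goodᶜ = 0 :=
    Φ.measure_compl_good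
  exact measure_eq_zero_iff_ae_notMem.1 h |>.mono fun z hz => by simpa using hz

/-- **Conservation of the kinetic energy along the flow** on the good set:
`∑ᵢ |vᵢ(t)|² = ∑ᵢ |vᵢ(0)|²`. [folklore] -/
theorem sum_norm_vel_sq_flow (Φ : HardSphereFlow (Torus.geometry (Fin 3)) ε n) {z : Config n (Fin 3) T3}
    (hz : z ∈ Φ.good) (t : ℝ) :
    ∑ i, ‖(Φ.flow t z i).2‖ ^ 2 = ∑ i, ‖(z i).2‖ ^ 2 := by
  have h := IsHardSphereTrajectory.configEnergy_eq_holds (Φ.isTrajectory z hz) t 0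
  simp only [Φ.flow_zero z hz, configEnergy] at h
  have h2 : (2 : ℝ)⁻¹ ≠ 0 := by norm_num
  exact mul_left_cancel₀ h2 h

/-! ## The empirical fields are energy dominated -/

/-- `|(n⁻¹ ∑ᵢ χ(xᵢ) gᵢ)| ≤ C (1 + n⁻¹ ∑ᵢ |vᵢ|²)` when `|χ| ≤ C` and `|gᵢ| ≤ 1 + |vᵢ|²`. [folklore] -/
theorem abs_avg_mul_le {N : ℕ} (z : Config N (Fin 3) T3) {χ : T3 → ℝ} {C : ℝ}
    (hC : ∀ x, |χ x| ≤ C) (g : Fin N → ℝ) (hg : ∀ i, |g i| ≤ 1 + ‖(z i).2‖ ^ 2) :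
    |(N : ℝ)⁻¹ * ∑ i, χ (z i).1 * g i| ≤ C * (1 + (N : ℝ)⁻¹ * ∑ i, ‖(z i).2‖ ^ 2) := by
  have hC0 : 0 ≤ C := (abs_nonneg _).trans (hC 0)
  rcases Nat.eq_zero_or_pos N with rfl | hN
  · simp [hC0]
  have hn : (0 : ℝ) < (N : ℝ) := by exact_mod_cast hN
  rw [abs_mul, abs_inv, abs_of_pos hn]
  have hsum : |∑ i, χ (z i).1 * g i| ≤ ∑ i, C * (1 + ‖(z i).2‖ ^ 2) := by
    refine (Finset.abs_sum_le_sum_abs _ _).trans (Finset.sum_le_sum fun i _ => ?_)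
    rw [abs_mul]
    exact mul_le_mul (hC _) (hg i) (abs_nonneg _) hC0
  calc (N : ℝ)⁻¹ * |∑ i, χ (z i).1 * g i| ≤ (N : ℝ)⁻¹ * ∑ i, C * (1 + ‖(z i).2‖ ^ 2) :=
        mul_le_mul_of_nonneg_left hsum (inv_nonneg.2 hn.le)
    _ = C * (1 + (N : ℝ)⁻¹ * ∑ i, ‖(z i).2‖ ^ 2) := by
        rw [← Finset.mul_sum, Finset.sum_add_distrib]
        simp only [Finset.sum_const, Finset.card_univ, Fintype.card_fin, nsmul_eq_mul, mul_one]
        field_simp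

/-- The empirical density field is energy dominated: `|ρ_N(χ)| ≤ C (1 + n⁻¹ ∑ |vᵢ|²)` for
`|χ| ≤ C`. [folklore] -/
theorem abs_empiricalDensityField_le {N : ℕ} (z : Config N (Fin 3) T3) {χ : T3 → ℝ} {C : ℝ}
    (hC : ∀ x, |χ x| ≤ C) :
    |empiricalDensityField z χ| ≤ C * (1 + (N : ℝ)⁻¹ * ∑ i, ‖(z i).2‖ ^ 2) := by
  rw [empiricalDensityField_eq_sum]
  have h := abs_avg_mul_le z hC (fun _ => 1) (fun i => by
    rw [abs_one]; nlinarith [sq_nonneg ‖(z i).2‖])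
  simpa using h

/-- A momentum coordinate of the empirical momentum field is energy dominated. [folklore] -/
theorem abs_empiricalMomentumField_apply_le {N : ℕ} (z : Config N (Fin 3) T3) {χ : T3 → ℝ} {C : ℝ}
    (hC : ∀ x, |χ x| ≤ C) (j : Fin 3) :
    |empiricalMomentumField z χ j| ≤ C * (1 + (N : ℝ)⁻¹ * ∑ i, ‖(z i).2‖ ^ 2) := by
  rw [empiricalMomentumField_eq_sum]
  have h := abs_avg_mul_le z hC (fun i => (z i).2 j) (fun i => by
    have h1 : |(z i).2 j| ≤ ‖(z i).2‖ := by
      simpa using PiLp.norm_apply_le (p := 2) (z i).2 j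
    nlinarith [sq_nonneg (‖(z i).2‖ - 1), abs_nonneg ((z i).2 j)])
  simpa [Finset.sum_apply, PiLp.smul_apply, WithLp.ofLp_sum] using h

/-- The empirical energy field is energy dominated. [folklore] -/
theorem abs_empiricalEnergyField_le {N : ℕ} (z : Config N (Fin 3) T3) {χ : T3 → ℝ} {C : ℝ}
    (hC : ∀ x, |χ x| ≤ C) :
    |empiricalEnergyField z χ| ≤ C * (1 + (N : ℝ)⁻¹ * ∑ i, ‖(z i).2‖ ^ 2) := by
  rw [empiricalEnergyField_eq_sum]
  exact abs_avg_mul_le z hC (fun i => ‖(z i).2‖ ^ 2 / 2) (fun i => by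
    rw [abs_of_nonneg (by positivity)]
    nlinarith [sq_nonneg ‖(z i).2‖])

end Summit.AtomisticToContinuum.HydrodynamicLimit.Theorems.OneSphereInfluenceAssembly

end
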